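import Summits.KontsevichZagierPeriods.KontsevichZagierPeriods.Theorems.HermiteRigidityPadeBoxIslands
import Summits.KontsevichZagierPeriods.KontsevichZagierPeriods.Theorems.HermiteRigidityDilogRigidityCubeTwoSeries
import Summits.KontsevichZagierPeriods.KontsevichZagierPeriods.Theorems.HermiteRigidityReductionRigidityPadeBoxIslandsAllWeights
import Literature.NumberTheory.DiophantineApproximation.DilogLinearIndependence

/-!
# `ReductionRigidity` (stmt-KontsevichZagierPeriods-3407), line `Sketch`, growth programme
# DilogRigidity: THE FIRST UNCONDITIONAL WEIGHT-TWO PADÉ BOX ISLANDS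

Route `KontsevichZagierPeriods/HermiteRigidity`, crux `ReductionRigidity` (lead c5). The (2, 1/N)
Padé box island `padeBoxKernelTwo N` (Theorems/HermiteRigidityPadeBoxIslands.lean) is Conjecture 1
of Kontsevich–Zagier in KERNEL FORM on the box sector generated by `[□², x^a y^b/(N − xy)^m]`,
`[□¹, x^a/(N − x)^m]`, `[pt, q]`, CONDITIONAL on the inlined `ℚ`-rigidity of its three normal-form
values `1`, `L₁ = ∫_□ dx/(N − x)`, `L₂ = ∫_□² dxdy/(N − xy)`. This file DISCHARGES that hypothesis
for every `N ≥ 10¹⁵`: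

* `stub_cubeOneIntegralSeries` — `L₁ = ∑_{k≥1} N^{-k}/k` (`= log(N/(N−1)) = Li₁(1/N)`);
  with the landed `stub_cubeTwoIntegralSeries` (`L₂ = ∑_{k≥1} N^{-k}/k² = Li₂(1/N)`) the two
  box integrals are the polylogarithmic series `DilogPade.polylogSeries s (1/N)`;
* `stub_dilogRigidity` — `1, L₁, L₂` are linearly independent over `ℚ` for `N ≥ 10¹⁵`, by the
  Literature theorem `one_polylogOne_polylogTwo_linearIndependent` (valid for `N ≥ 10¹⁰`;
  type-I Hermite–Padé forms, prime number theorem, Stirling, two-rate transference; a large-`N`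
  case of Nikišin 1979 / Hata 1990 / David–Hirata-Kohno–Kawashima 2020, Thm 2.1);
* `stub_padeBoxKernelTwoUnconditional` — hence `padeBoxKernelTwo N` holds with NO hypothesis for
  every `N ≥ 10¹⁵`: the first weight-two islands of the Kontsevich–Zagier calculus on which
  Conjecture 1 (kernel form) is a theorem.

References: M. Kontsevich, D. Zagier, *Periods* (2001), §1.2 [cite: KontsevichZagier2001, §1.2];
S. David, N. Hirata-Kohno, M. Kawashima, Moscow J. Comb. Number Th. 9 (2020), Thm 2.1
[cite: DavidHirataKohnoKawashima2020, Thm 2.1].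
-/

noncomputable section

open MeasureTheory Set

namespace Summit.KontsevichZagierPeriods.HermiteRigidity.ReductionRigidity

open Literature.NumberTheory.Transcendental
open Literature.NumberTheory.Transcendental.KZ
open Literature.NumberTheory.DiophantineApproximation

/-- STUB `cubeOneIntegralSeries` (growth programme DilogRigidity, line `Sketch`, crux
stmt-KontsevichZagierPeriods-3407): the weight-one normal-form value is the logarithmic series,
`∫_□ dx/(N − x) = ∑_{k≥1} N^{-k}/k` (`= log(N/(N−1))`) for `N ≥ 2`. Proof: the tree's
`integral_cube_one_one_div_sub` (value `log(N/(N−1))`) and `DilogPade.polylogSeries_one_eq_log`.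
[folklore] -/
theorem stub_cubeOneIntegralSeries : ∀ (N : ℕ), 2 ≤ N →
    ∫ p in cube 1, 1 / ((N : ℝ) - p 0) = ∑' k : ℕ, (1 / (N : ℝ)) ^ (k + 1) / ((k : ℝ) + 1) := by
  intro N hN
  rw [integral_cube_one_one_div_sub hN, ← DilogPade.polylogSeries_one_eq_log hN,
    DilogPade.polylogSeries]
  exact tsum_congr fun k => by rw [pow_one]

/-- The two box integrals are the polylogarithmic series `L_s(1/N)`, `s = 1, 2`. [folklore] -/
theorem integral_cube_eq_polylogSeries {N : ℕ} (hN : 2 ≤ N) :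
    (∫ p in cube 1, 1 / ((N : ℝ) - p 0)) = DilogPade.polylogSeries 1 (1 / (N : ℝ)) ∧
      (∫ p in cube 2, 1 / ((N : ℝ) - p 0 * p 1)) = DilogPade.polylogSeries 2 (1 / (N : ℝ)) := by
  refine ⟨?_, stub_cubeTwoIntegralSeries N hN⟩
  rw [stub_cubeOneIntegralSeries N hN, DilogPade.polylogSeries]
  exact tsum_congr fun k => by rw [pow_one]

/-- STUB `dilogRigidity` (growth programme DilogRigidity, line `Sketch`, crux
stmt-KontsevichZagierPeriods-3407): **the inlined rigidity hypothesis of the weight-two island is a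
theorem for `N ≥ 10¹⁵`** — `1`, `L₁ = ∫_□ dx/(N−x)`, `L₂ = ∫_□² dxdy/(N−xy)` are linearly
independent over `ℚ`. By `one_polylogOne_polylogTwo_linearIndependent` (`N ≥ 10¹⁰`) after
identifying the integrals with the series. [cite: DavidHirataKohnoKawashima2020, Thm 2.1] -/
theorem stub_dilogRigidity : ∀ (N : ℕ), 10 ^ 15 ≤ N → ∀ a b c : ℚ,
    (a : ℝ) + b * (∫ p in cube 1, 1 / ((N : ℝ) - p 0)) +
        c * (∫ p in cube 2, 1 / ((N : ℝ) - p 0 * p 1)) = 0 → a = 0 ∧ b = 0 ∧ c = 0 := by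
  intro N hN a b c h
  have hN2 : 2 ≤ N := le_trans (by norm_num) hN
  obtain ⟨h1, h2⟩ := integral_cube_eq_polylogSeries hN2
  rw [h1, h2] at h
  exact one_polylogOne_polylogTwo_linearIndependent N (le_trans (by norm_num) hN) a b c h

/-- STUB `padeBoxKernelTwoUnconditional` (growth programme DilogRigidity, line `Sketch`, crux
stmt-KontsevichZagierPeriods-3407): **the first unconditional weight-two islands** — for every
integer `N ≥ 10¹⁵`, Conjecture 1 of Kontsevich–Zagier in kernel form on the `(2, 1/N)` box sector:
every `ℤ`-combination of the generators `[□², x^a y^b/(N−xy)^m]`, `[□¹, x^c/(N−x)^m]`, `[pt, q]` of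
value `0` lies in `KZ.relations`, with NO rigidity hypothesis (`padeBoxKernelTwo` fed with
`stub_dilogRigidity`). [cite: KontsevichZagier2001, §1.2] -/
theorem stub_padeBoxKernelTwoUnconditional : ∀ (N : ℕ), 10 ^ 15 ≤ N → ∀ c ∈ AddSubgroup.closure
      ({c | ∃ (r : IntegralRep 2) (a b m : ℕ), r.domain = cube 2 ∧
          EqOn r.integrand (fun p => p 0 ^ a * p 1 ^ b / ((N : ℝ) - p 0 * p 1) ^ m) (cube 2) ∧
          c = KZ.of r} ∪
       {c | ∃ (r : IntegralRep 1) (a m : ℕ), r.domain = cube 1 ∧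
          EqOn r.integrand (fun p => p 0 ^ a / ((N : ℝ) - p 0) ^ m) (cube 1) ∧ c = KZ.of r} ∪
       {c | ∃ (r : IntegralRep 0) (q : ℚ), r.domain = cube 0 ∧
          EqOn r.integrand (fun _ => (q : ℝ)) (cube 0) ∧ c = KZ.of r}),
      KZ.eval c = 0 → c ∈ KZ.relations :=
  fun N hN => PadeBoxIslands.padeBoxKernelTwo N (le_trans (by norm_num) hN) (stub_dilogRigidity N hN)

/-- STUB `padeBoxKernelGenTwoUnconditional` (growth programme DilogRigidity, line `Sketch`, crux
stmt-KontsevichZagierPeriods-3407): the same unconditional weight-two island in the syntax of the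
every-weight programme `padeBoxKernelGen` (Theorems/…PadeBoxIslandsAllWeights.lean): for every
integer `N ≥ 10¹⁵`, Conjecture 1 in kernel form on the sector of ALL box generators
`[□ʲ, ∏ x_l^{a_l}/(N − ∏ x_l)^m]` of dimension `j ≤ 2` (constants `j = 0` included), with NO
rigidity hypothesis: the three normal-form values `L₀ = 1/(N−1)`, `L₁`, `L₂` are `ℚ`-independent by
`stub_dilogRigidity` (`L₀` is rational). [cite: KontsevichZagier2001, §1.2] -/
theorem stub_padeBoxKernelGenTwoUnconditional : ∀ (N : ℕ), 10 ^ 15 ≤ N → ∀ c ∈ AddSubgroup.closure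
      {c | ∃ (j : ℕ) (r : IntegralRep j) (a : Fin j → ℕ) (m : ℕ), j ≤ 2 ∧ r.domain = cube j ∧
          EqOn r.integrand (fun p => (∏ l, p l ^ a l) / ((N : ℝ) - ∏ l, p l) ^ m) (cube j) ∧
          c = KZ.of r},
      KZ.eval c = 0 → c ∈ KZ.relations := by
  intro N hN
  have hN2 : 2 ≤ N := le_trans (by norm_num) hN
  refine stub_padeBoxKernelGen 2 N hN2 fun β hβ => ?_
  have hN1 : (N : ℝ) - 1 ≠ 0 := by
    have : (2 : ℝ) ≤ N := by exact_mod_cast hN2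
    linarith
  have hN1q : (N : ℚ) - 1 ≠ 0 := by
    have : (2 : ℚ) ≤ N := by exact_mod_cast hN2
    linarith
  -- `Σ_{i<3} βᵢ Lᵢ = β₀/(N − 1) + β₁ L₁ + β₂ L₂`
  rw [Finset.sum_range_succ, Finset.sum_range_succ, Finset.sum_range_one] at hβ
  have hL0 : (∫ p in cube 0, 1 / ((N : ℝ) - ∏ l, p l)) = 1 / ((N : ℝ) - 1) := by
    have hcube : cube 0 = (univ : Set (Fin 0 → ℝ)) := eq_univ_of_forall fun x i => i.elim0
    rw [hcube, setIntegral_univ, Measure.volume_pi_eq_dirac (default : Fin 0 → ℝ), integral_dirac]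
    simp
  have hL1 : (∫ p in cube 1, 1 / ((N : ℝ) - ∏ l, p l)) = ∫ p in cube 1, 1 / ((N : ℝ) - p 0) := by
    refine setIntegral_congr_fun measurableSet_cube fun p _ => ?_
    simp
  have hL2 : (∫ p in cube 2, 1 / ((N : ℝ) - ∏ l, p l)) =
      ∫ p in cube 2, 1 / ((N : ℝ) - p 0 * p 1) := by
    refine setIntegral_congr_fun measurableSet_cube fun p _ => ?_
    simp [Fin.prod_univ_two]
  rw [hL0, hL1, hL2] at hβ
  have h := stub_dilogRigidity N hN (β 0 / ((N : ℚ) - 1)) (β 1) (β 2) (by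
    push_cast
    linear_combination hβ)
  obtain ⟨h0, h1, h2⟩ := h
  have hβ0 : β 0 = 0 := by
    rcases (div_eq_zero_iff).1 h0 with h | h
    · exact h
    · exact absurd h hN1q
  intro i hi
  have hi3 : i < 3 := by simpa using hi
  interval_cases i
  · exact hβ0
  · exact h1
  · exact h2

end Summit.KontsevichZagierPeriods.HermiteRigidity.ReductionRigidity

end
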